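import Mathlib
import Literature.NumberTheory.Automorphic.HilbertModularFormQExpansion
import Literature.NumberTheory.LFunctions.DedekindZetaTheta
import Summits.Langlands.Langlands.Theorems.CapacityClassicalityHilbertIntegralOverconvergentIsCongruenceKoecherPrinciple

/-!
# The theta series of one square as a `q`-series (stub `stub_theta_qSeries` of line Sketch-ideate-r1-k1)

Section V of line Sketch-ideate-r1-k1 of the crux `HilbertIntegralOverconvergentIsCongruence`
(stmt-Langlands-8485) studies the theta series `Θ(z) = ∑_{x ∈ 𝓞 F} e^{2πi S(x² z)}` of a totally
real field `F`.  This file proves the registered stub `stub_theta_qSeries`, the `q`-series side of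
`Θ`:

* the lattice Gaussian `∑_{x ∈ 𝓞 F} e^{-2π ∑_σ y_σ σ(x)²}` converges for `y ≫ 0`: it is a subseries
  of the theta series `θ_{(1)}(iy')` of the unit ideal of
  `Literature/NumberTheory/LFunctions/DedekindZetaTheta` (`summable_thetaIdeal_holds`, Neukirch,
  *Algebraic Number Theory*, VII (3.5)) at the height `y'_w = 2 y_{σ_w}`, where `w ↦ σ_w` is the
  bijection between infinite places and real embeddings of the totally real field `F`;
* grouping the `x`-sum along the squaring map `x ↦ x² ∈ 𝓞 F ⊆ 𝔡⁻¹` (Mathlib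
  `HasSum.tsum_fiberwise`; the fibre over `ν` has `r(ν) = #{x : x² = ν}` elements and the summand
  is constant on it, `tsum_const`) gives the convergence of `∑_ν r(ν) e^{-2π⟨ν,y⟩}` and the
  `q`-series identity `Θ(z) = ∑_ν r(ν) e^{2πi S(νz)}` on `ℍ`;
* `r(0) = 1`, `r(1) = 2` (`x² = 1 ⇔ x = ±1`, `1 ≠ -1`); `r(ν) ≠ 0 ⇒ ν = x²` is `0` or totally
  positive and lies in `𝔡⁻¹` (`Tr` of an algebraic integer is an integer);
* `Θ(z + b) = Θ(z)` for `b ∈ 𝓞 F` termwise: `S(x²(z + b)) = S(x² z) + Tr(x² b)`, `e^{2πi n} = 1`.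
-/

set_option linter.dupNamespace false

noncomputable section

namespace Summit.Langlands.Langlands.Theorems.HilbertIntegralOverconvergentIsCongruence

open MeasureTheory Complex NumberField
open Literature.NumberTheory.Automorphic Literature.NumberTheory.Automorphic.HilbertModular
open scoped MatrixGroups nonZeroDivisors

variable {F : Type} [Field F] [NumberField F]

/-! ### The squaring map into the dual lattice and its fibres -/

/-- The trace of `x² a` is a rational integer for algebraic integers `x, a`: the square of an
algebraic integer lies in the dual lattice `𝔡⁻¹ = {ν : Tr(ν a) ∈ ℤ ∀ a ∈ 𝓞 F} ⊇ 𝓞 F`. [folklore] -/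
theorem tqs_sq_mem_dual (x a : 𝓞 F) :
    ∃ n : ℤ, Algebra.trace ℚ F (((x : 𝓞 F) : F) ^ 2 * a) = n := by
  have hx : IsIntegral ℤ (((x : 𝓞 F) : F) ^ 2 * a) :=
    ((RingOfIntegers.isIntegral_coe x).pow 2).mul (RingOfIntegers.isIntegral_coe a)
  obtain ⟨n, hn⟩ := IsIntegrallyClosed.isIntegral_iff.mp (Algebra.isIntegral_trace (L := ℚ) hx)
  exact ⟨n, by rw [← hn, eq_intCast]⟩

/-- Membership in a fibre of a squaring map `s : x ↦ x²` into the dual lattice. [folklore] -/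
theorem tqs_mem_fiber_iff
    {s : 𝓞 F → {ν : F | ∀ a : 𝓞 F, ∃ n : ℤ, Algebra.trace ℚ F (ν * a) = n}}
    (hs : ∀ x, (s x : F) = ((x : 𝓞 F) : F) ^ 2) {x : 𝓞 F}
    {ν : {ν : F | ∀ a : 𝓞 F, ∃ n : ℤ, Algebra.trace ℚ F (ν * a) = n}} :
    x ∈ s ⁻¹' {ν} ↔ ((x : 𝓞 F) : F) ^ 2 = (ν : F) := by
  rw [Set.mem_preimage, Set.mem_singleton_iff, Subtype.ext_iff, hs]

/-- The fibre of the squaring map over `ν` is `{x ∈ 𝓞 F : x² = ν}`; in particular both have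
`r(ν) = #{x : x² = ν}` elements. [folklore] -/
theorem tqs_card_fiber
    {s : 𝓞 F → {ν : F | ∀ a : 𝓞 F, ∃ n : ℤ, Algebra.trace ℚ F (ν * a) = n}}
    (hs : ∀ x, (s x : F) = ((x : 𝓞 F) : F) ^ 2)
    (ν : {ν : F | ∀ a : 𝓞 F, ∃ n : ℤ, Algebra.trace ℚ F (ν * a) = n}) :
    Nat.card (s ⁻¹' {ν}) = Nat.card {x : 𝓞 F // ((x : 𝓞 F) : F) ^ 2 = (ν : F)} :=
  Nat.card_congr (Equiv.subtypeEquivRight fun _ ↦ tqs_mem_fiber_iff hs)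

/-- A function of `x` that only depends on `x² = ν` sums over the fibre of the squaring map over
`ν` to `r(ν) •` its value (`tsum_const`; no finiteness needed). [folklore] -/
theorem tqs_tsum_fiber {G : Type*} [NormedAddCommGroup G]
    {s : 𝓞 F → {ν : F | ∀ a : 𝓞 F, ∃ n : ℤ, Algebra.trace ℚ F (ν * a) = n}}
    (hs : ∀ x, (s x : F) = ((x : 𝓞 F) : F) ^ 2) (f : 𝓞 F → G) (c : G)
    (ν : {ν : F | ∀ a : 𝓞 F, ∃ n : ℤ, Algebra.trace ℚ F (ν * a) = n})
    (hf : ∀ x : 𝓞 F, ((x : 𝓞 F) : F) ^ 2 = (ν : F) → f x = c) :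
    ∑' x : ↥(s ⁻¹' {ν}), f x = Nat.card {x : 𝓞 F // ((x : 𝓞 F) : F) ^ 2 = (ν : F)} • c := by
  rw [← tqs_card_fiber hs ν, ← tsum_const c]
  exact tsum_congr fun x ↦ hf x ((tqs_mem_fiber_iff hs).mp x.2)

/-- `∑_σ σ(x²) t_σ = ∑_σ t_σ σ(x)²`. [folklore] -/
theorem tqs_sum_embedding_sq (x : F) (t : (F →+* ℝ) → ℝ) :
    ∑ σ : F →+* ℝ, σ (x ^ 2) * t σ = ∑ σ : F →+* ℝ, t σ * σ x ^ 2 :=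
  Finset.sum_congr rfl fun σ _ ↦ by rw [map_pow, mul_comm]

/-! ### Convergence of the lattice Gaussian (Neukirch VII (3.5) for the unit ideal) -/

omit [NumberField F] in
/-- `|x|_w = |σ_w(x)|` squared, `σ_w` the real embedding of the (real) infinite place `w`. [folklore] -/
theorem tqs_sq_apply_infinitePlace [NumberField.IsTotallyReal F] (w : InfinitePlace F) (x : F) :
    (w x) ^ 2 = (InfinitePlace.embedding_of_isReal (IsTotallyReal.isReal w) x) ^ 2 := by
  rw [← InfinitePlace.norm_embedding_of_isReal (IsTotallyReal.isReal w) x, Real.norm_eq_abs,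
    sq_abs]

omit [NumberField F] in
variable (F) in
/-- For `F` totally real, `w ↦ σ_w` (the real embedding of the real place `w`) is a bijection from
the infinite places onto the real embeddings (inverse `σ ↦` the place of `ℝ ∘ σ`). [folklore] -/
theorem tqs_realEmb_bijective [NumberField.IsTotallyReal F] :
    Function.Bijective (fun w : InfinitePlace F ↦
      InfinitePlace.embedding_of_isReal (IsTotallyReal.isReal w)) := by
  refine ⟨fun w w' h ↦ ?_, fun σ ↦ ⟨InfinitePlace.mk (Complex.ofRealHom.comp σ), ?_⟩⟩
  · have h' : InfinitePlace.embedding w = InfinitePlace.embedding w' := by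
      ext x
      have hx := congrArg (fun τ : F →+* ℝ ↦ ((τ x : ℝ) : ℂ)) h
      simpa only [InfinitePlace.embedding_of_isReal_apply] using hx
    rw [← InfinitePlace.mk_embedding w, h', InfinitePlace.mk_embedding]
  · ext x
    apply Complex.ofReal_injective
    rw [InfinitePlace.embedding_of_isReal_apply,
      InfinitePlace.embedding_mk_eq_of_isReal (kD_isReal_ofRealHom_comp σ)]
    rfl

/-- Neukirch's form `⟨xy', x⟩ = ∑_w e_w y'_w |x|_w²` at the height `y'_w = 2 y_{σ_w}` is
`2 ∑_σ y_σ σ(x)²` (all places are real, `e_w = 1`, `|x|_w² = σ_w(x)²`, and `w ↦ σ_w` is a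
bijection). [folklore] -/
theorem tqs_minkowskiQuadForm_eq [NumberField.IsTotallyReal F] (y : (F →+* ℝ) → ℝ) (x : F) :
    Literature.NumberTheory.LFunctions.NumberField.minkowskiQuadForm F
        (fun w ↦ 2 * y (InfinitePlace.embedding_of_isReal (IsTotallyReal.isReal w))) x =
      2 * ∑ σ : F →+* ℝ, y σ * σ x ^ 2 := by
  simp only [Literature.NumberTheory.LFunctions.NumberField.minkowskiQuadForm, Finset.mul_sum]
  refine Fintype.sum_bijective _ (tqs_realEmb_bijective F) _ _ fun w ↦ ?_
  rw [IsTotallyReal.mult_eq, Nat.cast_one, one_mul, tqs_sq_apply_infinitePlace, mul_assoc]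

variable (F) in
/-- **Clause (1): convergence of the lattice Gaussian.** For `y ≫ 0` the series
`∑_{x ∈ 𝓞 F} e^{-2π ∑_σ y_σ σ(x)²}` converges: it is a subseries (along `𝓞 F ↪ (1 : 𝔞)`) of the
theta series of the unit ideal at the height `y'_w = 2 y_{σ_w}` (Neukirch VII (3.5),
`summable_thetaIdeal_holds`). [folklore] -/
theorem tqs_summable_gaussian [NumberField.IsTotallyReal F] (y : (F →+* ℝ) → ℝ)
    (hy : ∀ σ, 0 < y σ) :
    Summable (fun x : 𝓞 F ↦
      Real.exp (-(2 * Real.pi * ∑ σ : F →+* ℝ, y σ * σ (x : F) ^ 2))) := by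
  have hS := Literature.NumberTheory.LFunctions.NumberField.summable_thetaIdeal_holds F 1
    (fun w ↦ 2 * y (InfinitePlace.embedding_of_isReal (IsTotallyReal.isReal w)))
    fun w ↦ mul_pos two_pos (hy _)
  let i : 𝓞 F → ↥(1 : FractionalIdeal (𝓞 F)⁰ F) := fun x ↦
    ⟨(x : F), (FractionalIdeal.mem_one_iff (𝓞 F)⁰).mpr ⟨x, rfl⟩⟩
  have hi : Function.Injective i := fun a b hab ↦ by
    have h := congrArg (fun t : ↥(1 : FractionalIdeal (𝓞 F)⁰ F) ↦ (t : F)) hab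
    exact RingOfIntegers.ext h
  refine (hS.comp_injective hi).congr fun x ↦ ?_
  change Literature.NumberTheory.LFunctions.NumberField.thetaSummand F _ (x : F) = _
  rw [Literature.NumberTheory.LFunctions.NumberField.thetaSummand, tqs_minkowskiQuadForm_eq]
  congr 1
  ring

/-! ### The theta series and its `q`-series -/

/-- The size of a theta term: `|e^{2πi S(x² z)}| = e^{-2π ∑_σ Im z_σ σ(x)²}`. [folklore] -/
theorem tqs_norm_thetaTerm (x : 𝓞 F) (z : Point F) :
    ‖cexp (2 * Real.pi * I * pairing (((x : 𝓞 F) : F) ^ 2) z)‖ =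
      Real.exp (-(2 * Real.pi * ∑ σ : F →+* ℝ, (z σ).im * σ (x : F) ^ 2)) := by
  have h := kp_norm_qTerm 1 (((x : 𝓞 F) : F) ^ 2) z
  rw [one_mul, norm_one, one_mul] at h
  rw [h, tqs_sum_embedding_sq (x : F) (fun σ ↦ (z σ).im)]

variable (F) in
/-- On `ℍ` the theta series converges absolutely. [folklore] -/
theorem tqs_summable_thetaTerm [NumberField.IsTotallyReal F] {z : Point F}
    (hz : z ∈ halfSpace F) :
    Summable (fun x : 𝓞 F ↦ cexp (2 * Real.pi * I * pairing (((x : 𝓞 F) : F) ^ 2) z)) :=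
  Summable.of_norm ((tqs_summable_gaussian F (fun σ ↦ (z σ).im) hz).congr fun x ↦
    (tqs_norm_thetaTerm x z).symm)

variable (F) in
/-- **Clause (2): convergence of the weighted `q`-series majorant.** Grouping the lattice Gaussian
along `x ↦ x²` (`HasSum.tsum_fiberwise`), `∑_{ν ∈ 𝔡⁻¹} r(ν) e^{-2π⟨ν,y⟩}` converges. [folklore] -/
theorem tqs_summable_weighted [NumberField.IsTotallyReal F] (y : (F →+* ℝ) → ℝ)
    (hy : ∀ σ, 0 < y σ) :
    Summable (fun ν : {ν : F | ∀ a : 𝓞 F, ∃ n : ℤ, Algebra.trace ℚ F (ν * a) = n} ↦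
      ‖((Nat.card {x : 𝓞 F // ((x : 𝓞 F) : F) ^ 2 = (ν : F)} : ℕ) : ℂ)‖ *
        Real.exp (-(2 * Real.pi * ∑ σ : F →+* ℝ, σ (ν : F) * y σ))) := by
  set s : 𝓞 F → {ν : F | ∀ a : 𝓞 F, ∃ n : ℤ, Algebra.trace ℚ F (ν * a) = n} :=
    fun x ↦ ⟨((x : 𝓞 F) : F) ^ 2, tqs_sq_mem_dual x⟩ with hs_def
  have hs : ∀ x, (s x : F) = ((x : 𝓞 F) : F) ^ 2 := fun _ ↦ rfl
  have h := (tqs_summable_gaussian F y hy).hasSum.tsum_fiberwise s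
  refine h.summable.congr fun ν ↦ ?_
  rw [tqs_tsum_fiber hs
    (fun x : 𝓞 F ↦ Real.exp (-(2 * Real.pi * ∑ σ : F →+* ℝ, y σ * σ (x : F) ^ 2)))
    (Real.exp (-(2 * Real.pi * ∑ σ : F →+* ℝ, σ (ν : F) * y σ))) ν
    fun x hx ↦ by rw [← hx, tqs_sum_embedding_sq (x : F) y], nsmul_eq_mul, Complex.norm_natCast]

variable (F) in
/-- **Clause (3): the theta series is a `q`-series on `ℍ`.** Grouping the absolutely convergent
lattice sum along `x ↦ x²` (`HasSum.tsum_fiberwise`), the fibre over `ν` contributing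
`r(ν) e^{2πi S(νz)}`. [folklore] -/
theorem tqs_theta_eq_qSeries [NumberField.IsTotallyReal F] {z : Point F} (hz : z ∈ halfSpace F) :
    (∑' x : 𝓞 F, cexp (2 * Real.pi * I * pairing (((x : 𝓞 F) : F) ^ 2) z)) =
      ∑' ν : {ν : F | ∀ a : 𝓞 F, ∃ n : ℤ, Algebra.trace ℚ F (ν * a) = n},
        ((Nat.card {x : 𝓞 F // ((x : 𝓞 F) : F) ^ 2 = (ν : F)} : ℕ) : ℂ) *
          cexp (2 * Real.pi * I * pairing (ν : F) z) := by
  set s : 𝓞 F → {ν : F | ∀ a : 𝓞 F, ∃ n : ℤ, Algebra.trace ℚ F (ν * a) = n} :=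
    fun x ↦ ⟨((x : 𝓞 F) : F) ^ 2, tqs_sq_mem_dual x⟩ with hs_def
  have hs : ∀ x, (s x : F) = ((x : 𝓞 F) : F) ^ 2 := fun _ ↦ rfl
  have h := (tqs_summable_thetaTerm F hz).hasSum.tsum_fiberwise s
  refine h.tsum_eq.symm.trans (tsum_congr fun ν ↦ ?_)
  rw [tqs_tsum_fiber hs (fun x : 𝓞 F ↦ cexp (2 * Real.pi * I * pairing (((x : 𝓞 F) : F) ^ 2) z))
    (cexp (2 * Real.pi * I * pairing (ν : F) z)) ν fun x hx ↦ by rw [hx], nsmul_eq_mul]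

/-! ### The representation numbers `r(0)`, `r(1)` and the support of `r` -/

omit [NumberField F] in
/-- `r(0) = 1`: only `x = 0` has `x² = 0`. [folklore] -/
theorem tqs_card_sq_eq_zero : Nat.card {x : 𝓞 F // ((x : 𝓞 F) : F) ^ 2 = (0 : F)} = 1 := by
  haveI : Unique {x : 𝓞 F // ((x : 𝓞 F) : F) ^ 2 = (0 : F)} :=
    { default := ⟨0, by simp⟩
      uniq := fun x ↦ Subtype.ext
        (RingOfIntegers.coe_eq_zero_iff.mp ((pow_eq_zero_iff two_ne_zero).mp x.2)) }
  exact Nat.card_unique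

/-- `r(1) = 2`: `x² = 1 ⇔ x = ±1`, and `1 ≠ -1` in characteristic `0`. [folklore] -/
theorem tqs_card_sq_eq_one : Nat.card {x : 𝓞 F // ((x : 𝓞 F) : F) ^ 2 = (1 : F)} = 2 := by
  rw [Nat.card_eq_two_iff]
  refine ⟨⟨1, by simp⟩, ⟨-1, by simp⟩, fun h ↦ ?_, Set.eq_univ_of_forall fun x ↦ ?_⟩
  · have h' : ((1 : 𝓞 F) : F) = ((-1 : 𝓞 F) : F) :=
      congrArg (fun t : {x : 𝓞 F // ((x : 𝓞 F) : F) ^ 2 = (1 : F)} ↦ ((t.1 : 𝓞 F) : F)) h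
    simp only [map_one, map_neg] at h'
    have h2 : (2 : F) = 0 := by linear_combination h'
    exact two_ne_zero h2
  · rw [Set.mem_insert_iff, Set.mem_singleton_iff]
    rcases sq_eq_one_iff.mp x.2 with hx | hx
    · exact Or.inl (Subtype.ext (RingOfIntegers.ext (by simpa using hx)))
    · exact Or.inr (Subtype.ext (RingOfIntegers.ext (by simpa using hx)))

/-- **Clause (5):** if `r(ν) ≠ 0` then `ν = x²` for some `x ∈ 𝓞 F`, so `ν ∈ 𝔡⁻¹` and `ν` is `0`
(`x = 0`) or totally positive (`σ(ν) = σ(x)² > 0`): `ν` is a `q`-expansion index. [folklore] -/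
theorem tqs_mem_qIndexSet_of_card_ne_zero (ν : F)
    (h : Nat.card {x : 𝓞 F // ((x : 𝓞 F) : F) ^ 2 = ν} ≠ 0) : ν ∈ qIndexSet F := by
  obtain ⟨⟨x, hx⟩⟩ := (Nat.card_ne_zero.mp h).1
  subst hx
  refine ⟨tqs_sq_mem_dual x, ?_⟩
  by_cases hx0 : x = 0
  · left
    subst hx0
    simp
  · right
    intro σ
    rw [map_pow]
    exact sq_pos_iff.mpr ((map_ne_zero σ).mpr (RingOfIntegers.coe_ne_zero_iff.mpr hx0))

/-! ### `𝓞 F`-periodicity -/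

variable (F) in
/-- **Clause (6): `Θ(z + b) = Θ(z)` for `b ∈ 𝓞 F`**, termwise: `S(x²(z+b)) = S(x² z) + Tr(x² b)` with
`Tr(x² b) ∈ ℤ`, and `e^{2πi n} = 1`. [folklore] -/
theorem tqs_theta_periodic [NumberField.IsTotallyReal F] (b : 𝓞 F) (z : Point F) :
    (∑' x : 𝓞 F, cexp (2 * Real.pi * I *
        pairing (((x : 𝓞 F) : F) ^ 2) (fun σ ↦ z σ + ((σ (b : F) : ℝ) : ℂ)))) =
      ∑' x : 𝓞 F, cexp (2 * Real.pi * I * pairing (((x : 𝓞 F) : F) ^ 2) z) := by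
  obtain ⟨htr, -⟩ := stub_totallyReal_embeddings F
  refine tsum_congr fun x ↦ ?_
  obtain ⟨n, hn⟩ := koe_sum_mul_embedding_int htr (tqs_sq_mem_dual x) b
  have hphase : pairing (((x : 𝓞 F) : F) ^ 2) (fun σ ↦ z σ + ((σ (b : F) : ℝ) : ℂ)) =
      pairing (((x : 𝓞 F) : F) ^ 2) z + n := by
    simp only [pairing, mul_add, Finset.sum_add_distrib]
    congr 1
    exact_mod_cast hn
  rw [hphase, mul_add, Complex.exp_add]
  have h1 : cexp (2 * Real.pi * I * (n : ℂ)) = 1 := by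
    rw [show 2 * Real.pi * I * (n : ℂ) = n * (2 * Real.pi * I) by ring]
    exact Complex.exp_int_mul_two_pi_mul_I n
  rw [h1, mul_one]

/-! ### The stub -/

/-- **stub V1 — `stub_theta_qSeries` (M; the theta series as a `q`-series).** Over a totally real `F`: the lattice Gaussian sums
`∑_{x ∈ 𝓞F} e^{-2π ∑_σ y_σ σ(x)²}` converge for `y ≫ 0`; with `r(ν) = #{x ∈ 𝓞F : x² = ν}` (a finite cardinality, `≤ 2`) the weighted
sums `∑_{ν ∈ 𝔡⁻¹} r(ν) e^{-2π⟨ν,y⟩}` converge; on `ℍ` the theta series is the `q`-series `∑_ν r(ν) e^{2πi S(νz)}` (group the lattice sum by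
`ν = x²`); `r(0) = 1`, `r(1) = 2`; `r(ν) ≠ 0 ⇒ ν` is a cone index (a non-zero square of an integer is totally positive and lies in
`𝓞F ⊆ 𝔡⁻¹`); and `Θ` is `𝓞F`-periodic (`Tr(x²b) ∈ ℤ`). [folklore] -/
theorem stub_theta_qSeries (F : Type) [Field F] [NumberField F] [NumberField.IsTotallyReal F] :
    (∀ y : (F →+* ℝ) → ℝ, (∀ σ, 0 < y σ) →
      Summable (fun x : 𝓞 F ↦ Real.exp (-(2 * Real.pi * ∑ σ : F →+* ℝ, y σ * σ (x : F) ^ 2)))) ∧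
    (∀ y : (F →+* ℝ) → ℝ, (∀ σ, 0 < y σ) →
      Summable (fun ν : {ν : F | ∀ a : 𝓞 F, ∃ n : ℤ, Algebra.trace ℚ F (ν * a) = n} ↦
        ‖((Nat.card {x : 𝓞 F // ((x : 𝓞 F) : F) ^ 2 = (ν : F)} : ℕ) : ℂ)‖ *
          Real.exp (-(2 * Real.pi * ∑ σ : F →+* ℝ, σ (ν : F) * y σ)))) ∧
    (∀ z ∈ halfSpace F,
      (∑' x : 𝓞 F, cexp (2 * Real.pi * I * pairing (((x : 𝓞 F) : F) ^ 2) z)) =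
        ∑' ν : {ν : F | ∀ a : 𝓞 F, ∃ n : ℤ, Algebra.trace ℚ F (ν * a) = n},
          ((Nat.card {x : 𝓞 F // ((x : 𝓞 F) : F) ^ 2 = (ν : F)} : ℕ) : ℂ) *
            cexp (2 * Real.pi * I * pairing (ν : F) z)) ∧
    Nat.card {x : 𝓞 F // ((x : 𝓞 F) : F) ^ 2 = (0 : F)} = 1 ∧
    Nat.card {x : 𝓞 F // ((x : 𝓞 F) : F) ^ 2 = (1 : F)} = 2 ∧
    (∀ ν : F, Nat.card {x : 𝓞 F // ((x : 𝓞 F) : F) ^ 2 = ν} ≠ 0 → ν ∈ qIndexSet F) ∧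
    (∀ (b : 𝓞 F) (z : Point F),
      (∑' x : 𝓞 F, cexp (2 * Real.pi * I * pairing (((x : 𝓞 F) : F) ^ 2) (fun σ ↦ z σ + ((σ (b : F) : ℝ) : ℂ)))) =
        ∑' x : 𝓞 F, cexp (2 * Real.pi * I * pairing (((x : 𝓞 F) : F) ^ 2) z)) :=
  ⟨tqs_summable_gaussian F, tqs_summable_weighted F, fun _ hz ↦ tqs_theta_eq_qSeries F hz,
    tqs_card_sq_eq_zero, tqs_card_sq_eq_one, tqs_mem_qIndexSet_of_card_ne_zero,
    tqs_theta_periodic F⟩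

end Summit.Langlands.Langlands.Theorems.HilbertIntegralOverconvergentIsCongruence
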